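import Summits.Langlands.Langlands.Theorems.RamifiedCoefficientSeedAdjointLiftingGL3BirthDefs2
import Literature.NumberTheory.GaloisRepresentations.ModPGaloisRep
import Literature.NumberTheory.GaloisRepresentations.RamificationFiltration
import Literature.NumberTheory.Automorphic.AdicCompletionLocalField
import HarnessLib

/-!
# Route `RamifiedCoefficientSeed`, crux `AdjointLiftingGL3` (stmt-Langlands-16779): vocabulary of the
# line `birth`, part 3 (skeleton v5 interfaces: the aligned newform and the local shape at `p`)

Third vocabulary file of the line (`…BirthDefs.lean` p161710: the crux's clauses; `…BirthDefs2.lean`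
p164420: the v4 interfaces).  Two interfaces are added after wave 2:

* `WeightTwoNewformAlong p ρ₀ ι k ιk` — the CORRECTED output of the Khare–Wintenberger step (worker
  of stub S6, 2026-08-17): as `WeightTwoNewformFor`, plus the ALIGNMENT of the newform's coefficient
  map `ι_g : 𝓞_g → k` with the complex embedding `ι : ℚ̄_p ≃ ℂ` at which the seed is consumed —
  `ι_g(x) = ι⁻¹(x) mod 𝔪` — without which `r_ι(Ad π_g ⊗ χ)` reduces to `ad⁰` of `g` modulo an
  UNRELATED prime of `K_g` and the Galois seed is unprovable (S6 verdict `stub-misstated`).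
* `LocalShapeAt p ρ₀ η` — the output of the LOCAL Fontaine–Laffaille analysis at the place above `p`
  (stub S2a), in the vocabulary of the accepted `fundamentalCharacter` / `absInertia` /
  `absUpperInertia` of the completion `ℚ_v`, pulled back to `Γ_ℚ` along the fixed
  `absGaloisRestrict ℚ ℚ_v`: for every residual `τ₀` of `ρ₀` and reduction `η̄` of `η`,
  (E) `η̄ = ω⁻¹` on inertia; (T) after a twist by a power of `ω`, `τ₀` has on inertia either the
  level-one shape `(ω ∗; 0 1)` with the wild ramification groups `I^u`, `u > 1`, acting trivially
  (peu ramifié or split), or the level-two shape `diag(ω₂, ω₂^p)`.  Consumers: S2b (projective inertia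
  order `> 5`, Teichmüller twist) and S2c (Serre weight `2` ⇒ aligned weight-two newform under KW).

NOTHING IS ASSERTED; declared in the skeleton's namespace; no import of the route module.
-/

set_option linter.dupNamespace false -- `Summit.Langlands.Langlands` is the mandated namespace

noncomputable section

namespace Summit.Langlands.Langlands.Cruxes.AdjointLiftingGL3.Birth

open scoped MatrixGroups NumberField
open NumberField IsDedekindDomain Field Filter
open Literature.NumberTheory.GaloisRepresentations Literature.NumberTheory.PAdicHodge
open Literature.NumberTheory.Automorphic
open Literature.NumberTheory.EllipticCurves.ModularForms CongruenceSubgroup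
open Literature.NumberTheory.GaloisRepresentations.IsNonarchimedeanLocalField

/-- **A weight-two newform for `ρ₀`, ALIGNED WITH `ι`** (corrected interface for the Galois seed,
worker of stub S6): a level `M` prime to `p`, a newform `g ∈ S₂(Γ₁(M))`, `ι_g : 𝓞_g → k`, an
exponent `s`, a residual `τ₀` of `ρ₀` and `σ̄ = ω̄^s ⊗ τ₀` pushed into `k`, with `σ̄` attached to
`g` along `ι_g` away from `M p` — AND `ι_g(x) = ιk(ι⁻¹(x) mod 𝔪)` for every `x ∈ 𝓞_g` (the prime of
`K_g` above `p` is the one induced by `ι`). [cite: KhareWintenberger2009, Thm. 1.2]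
[cite: Serre1987, (3.2.4)] -/
def WeightTwoNewformAlong (p : ℕ) [Fact p.Prime] (ρ₀ : FramedGaloisRep ℚ (PadicAlgCl p) 2)
    (ι : PadicAlgCl p ≃+* ℂ) (k : Type) [Field k] [CharP k p] [TopologicalSpace k]
    (ιk : padicAlgClResidueField p →+* k) : Prop :=
  ∃ (M : ℕ) (_ : NeZero M) (g : CuspForm (Gamma1 M) 2) (ιg : coeffCharIntegers g →+* k) (s : ℕ)
    (τ₀ : absoluteGaloisGroup ℚ →* GL (Fin 2) (padicAlgClResidueField p)) (σb : ModPGaloisRep ℚ k 2),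
    ¬ p ∣ M ∧ IsNewform1 g ∧ IsGaloisRepOfNewform1Int g ιg {q | q ∣ M * p} σb ∧
      ρ₀.IsResidualRepOf (RingHom.id _) τ₀ ∧
      (∀ γ, ((σb γ : GL (Fin 2) k) : Matrix (Fin 2) (Fin 2) k) =
        ((ZMod.castHom (dvd_refl p) k (((omegaModP p γ) ^ s : (ZMod p)ˣ) : ZMod p)) •
          ((τ₀ γ : GL (Fin 2) (padicAlgClResidueField p)) :
            Matrix (Fin 2) (Fin 2) (padicAlgClResidueField p)).map ιk)) ∧
      ∀ x : coeffCharIntegers g,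
        ∃ hx : ι.symm ((x : coeffCharField g) : ℂ) ∈ padicAlgClIntegers p,
          ιg x = ιk (IsLocalRing.residue (padicAlgClIntegers p) ⟨ι.symm ((x : coeffCharField g) : ℂ), hx⟩)

/-- An aligned weight-two newform datum is in particular a weight-two newform datum (forget the
alignment clause). [folklore] -/
theorem weightTwoNewformFor_of_along :
    ∀ {p : ℕ} [Fact p.Prime] {ρ₀ : FramedGaloisRep ℚ (PadicAlgCl p) 2} {ι : PadicAlgCl p ≃+* ℂ}
      {k : Type} [Field k] [CharP k p] [TopologicalSpace k] {ιk : padicAlgClResidueField p →+* k},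
      WeightTwoNewformAlong p ρ₀ ι k ιk → WeightTwoNewformFor p ρ₀ k ιk := by
  intro p _ ρ₀ ι k _ _ _ ιk h
  obtain ⟨M, hM, g, ιg, s, τ₀, σb, hpM, hg, hgal, hτ₀, hσ, -⟩ := h
  exact ⟨M, hM, g, ιg, s, τ₀, σb, hpM, hg, hgal, hτ₀, hσ⟩

/-- **The local shape at `p` of the seed** (output of the Fontaine–Laffaille analysis, stub S2a).
For every place `v ∣ p` of `ℚ`, every residual representation `τ₀` of `ρ₀`, every reduction `η̄`
of `η`, every residue embedding `ιr` and uniformiser `ϖ` of the completion `ℚ_v`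
(`j = absGaloisRestrict ℚ ℚ_v : Γ_{ℚ_v} → Γ_ℚ`, `I = absInertia ℚ_v`, `ω = ψ₁`, `ω₂ = ψ₂` the
fundamental characters of levels one and two):
(E) `η̄(j σ) = ω(σ)⁻¹` for `σ ∈ I`;
(T) for some `s`, EITHER (level one) some conjugate of `τ₀ ∘ j` is `ω(σ)^s · (ω(σ) ∗; 0 1)` on `I`
and `τ₀ ∘ j` is trivial on every upper ramification group `I^u`, `u > 1` (peu ramifié, or split),
OR (level two) some conjugate of `τ₀ ∘ j` is `ω(σ)^s · diag(ω₂(σ), ω₂(σ)^p)` on `I`.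
On paper this is what Fontaine–Laffaille theory forces for `ρ ≅ η ⊗ ad⁰ ρ₀` crystalline of weights
`{0,1,2}` with `ρ̄` irreducible (wrong-order and très-ramifié extensions, niveau `3`, and the other
digit assignments are excluded). [cite: FontaineLaffaille1982, Thm. 5.3 (iii)]
[cite: Serre1987, §2.2–2.4] -/
def LocalShapeAt (p : ℕ) [Fact p.Prime] (ρ₀ : FramedGaloisRep ℚ (PadicAlgCl p) 2)
    (η : FramedGaloisRep ℚ (PadicAlgCl p) 1) : Prop :=
  ∀ (v : HeightOneSpectrum (𝓞 ℚ)) (_hv : ((p : ℕ) : 𝓞 ℚ) ∈ v.asIdeal)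
    (τ₀ : absoluteGaloisGroup ℚ →* GL (Fin 2) (padicAlgClResidueField p))
    (ηb : absoluteGaloisGroup ℚ →* GL (Fin 1) (padicAlgClResidueField p)),
    ρ₀.IsResidualRepOf (RingHom.id _) τ₀ → η.IsReductionOf (RingHom.id _) ηb →
    ∀ (ιr : absIntegers (↥(ValuativeRel.valuation (v.adicCompletion ℚ)).integer) (v.adicCompletion ℚ) ⧸
          absMaximalIdeal (v.adicCompletion ℚ) →+* padicAlgClResidueField p)
      (ϖ : ↥(ValuativeRel.valuation (v.adicCompletion ℚ)).integer) (hϖ : Irreducible ϖ),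
      -- (E) `η̄|_I = ω⁻¹`
      (∀ σ : ↥(absInertia (v.adicCompletion ℚ)),
          ((ηb (absGaloisRestrict ℚ (v.adicCompletion ℚ) (σ : absoluteGaloisGroup _)) :
              GL (Fin 1) (padicAlgClResidueField p)) : Matrix (Fin 1) (Fin 1) _) 0 0 =
            (((fundamentalCharacter (v.adicCompletion ℚ) 1 ιr ϖ hϖ σ)⁻¹ :
              (padicAlgClResidueField p)ˣ) : padicAlgClResidueField p)) ∧
      -- (T) the inertial shape of `τ₀` up to a cyclotomic twist
      (∃ s : ℕ,
        (∃ P : GL (Fin 2) (padicAlgClResidueField p),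
            (∀ σ : ↥(absInertia (v.adicCompletion ℚ)), ∃ c : padicAlgClResidueField p,
              ((P * τ₀ (absGaloisRestrict ℚ (v.adicCompletion ℚ) (σ : absoluteGaloisGroup _)) * P⁻¹ :
                  GL (Fin 2) (padicAlgClResidueField p)) : Matrix (Fin 2) (Fin 2) _) =
                (((fundamentalCharacter (v.adicCompletion ℚ) 1 ιr ϖ hϖ σ) ^ s :
                    (padicAlgClResidueField p)ˣ) : padicAlgClResidueField p) •
                  !![(((fundamentalCharacter (v.adicCompletion ℚ) 1 ιr ϖ hϖ σ) :
                      (padicAlgClResidueField p)ˣ) : padicAlgClResidueField p), c;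
                    0, 1]) ∧
            ∀ u : ℝ, 1 < u → ∀ σ ∈ absUpperInertia (v.adicCompletion ℚ) u,
              τ₀ (absGaloisRestrict ℚ (v.adicCompletion ℚ) σ) = 1) ∨
        (∃ P : GL (Fin 2) (padicAlgClResidueField p),
            ∀ σ : ↥(absInertia (v.adicCompletion ℚ)),
              ((P * τ₀ (absGaloisRestrict ℚ (v.adicCompletion ℚ) (σ : absoluteGaloisGroup _)) * P⁻¹ :
                  GL (Fin 2) (padicAlgClResidueField p)) : Matrix (Fin 2) (Fin 2) _) =
                (((fundamentalCharacter (v.adicCompletion ℚ) 1 ιr ϖ hϖ σ) ^ s :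
                    (padicAlgClResidueField p)ˣ) : padicAlgClResidueField p) •
                  !![(((fundamentalCharacter (v.adicCompletion ℚ) 2 ιr ϖ hϖ σ) :
                      (padicAlgClResidueField p)ˣ) : padicAlgClResidueField p), 0;
                    0, (((fundamentalCharacter (v.adicCompletion ℚ) 2 ιr ϖ hϖ σ) ^ p :
                      (padicAlgClResidueField p)ˣ) : padicAlgClResidueField p)]))

end Summit.Langlands.Langlands.Cruxes.AdjointLiftingGL3.Birth

end
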